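import Mathlib
import HarnessLib
import Literature.Computability.AlgebraicComplexity.OrbitClosureAnnihilatorCriterion
import Literature.Computability.AlgebraicComplexity.StandardFamiliesProofs
import Summits.ValiantsHypothesis.ValiantsHypothesis.Theorems.SchenstedIndexTracePowAnnihilator
import Summits.ValiantsHypothesis.ValiantsHypothesis.Theorems.SchenstedIndexPerThreeAnnihilatorDim
import Summits.ValiantsHypothesis.ValiantsHypothesis.Theorems.SchenstedIndexPowTraceCertificateTools

/-!
# Route SchenstedIndex — border power-trace complexity of `per_3` is at least `4` (geometric form)

Calibration rung K4 of route SchenstedIndex (`BorderPcPerThree`, stmt-ValiantsHypothesis-16085, asks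
for a COMBINATORIAL certificate `1_OF(t,3) ∉ span_3(t,3)`; the route's NUMBERS recorded
"border pc(per_3) ∈ [3, 7]").  This file settles the GEOMETRIC statement behind the rung by orbit
dimensions, with no certificate search:

* **`perPoly_three_not_mem_orbitClosure_tracePow_three`**: `per_3 ∉ Δ(tr X_3³)`, the Zariski closure of
  the `GL_9`-orbit of the power trace `Q = tr(X³)` of the generic `3 × 3` matrix — i.e. `per_3` is not a
  limit of width-3 power-trace representations `tr(A³)`, `A ∈ M_3(linear forms)`: BORDER `pc(per_3) ≥ 4`.
  Proof: `dim 𝔤𝔩(ℂ⁹)_{per_3} ≤ 4` (`finrank_glAnn_perPoly_three_le_four`) `< 8 ≤ dim 𝔤𝔩(ℂ⁹)_Q`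
  (`sq_sub_one_le_finrank_glAnn_tracePow_three`), so `dim Δ(per_3) = 77 > 73 ≥ dim Δ(Q)` and the
  annihilator criterion `not_mem_orbitClosure_of_finrank_glAnn_lt` (tree's `OrbitClosureDimension`)
  applies.
* **`not_exists_tracePow_three_repr_perPoly_three`**: in particular `per_3 ≠ tr(A³)` for every `3 × 3`
  matrix `A` of linear forms (exact `pc(per_3) ≥ 4`), since such a representation puts `per_3` in the
  endomorphism orbit `End(ℂ⁹)·Q ⊆ Δ(Q)` (`endOrbit_subset_orbitClosure_holds`).

What this does NOT give: the rung AS TYPED (a witness `t` with `1_OF(t,3) ∉ span_3(t,3)`), which needs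
the completeness transfer "`per_m ∉ Δ(tr X_n^m)` ⇒ some sector certificate exists" (polarisation of an
ideal element; see the count-vector form `borderPcPerThree_iff_count`).  Route-independent file.

HONEST FRAMING: a finite calibration fact about `per_3` (toy size); nothing here bears on `VP ≠ VNP`.
-/

set_option linter.dupNamespace false

noncomputable section

namespace Summit.ValiantsHypothesis.ValiantsHypothesis.Theorems.SchenstedIndex

open MvPolynomial Matrix
open Literature.Computability.AlgebraicComplexity

/-- Entries of powers of the generic matrix are forms: `((X)^k)_{ij}` is homogeneous of degree `k`. -/
theorem isHomogeneous_mvPolynomialX_pow_apply (n k : ℕ) (i j : Fin n) :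
    ((Matrix.mvPolynomialX (Fin n) (Fin n) ℂ ^ k) i j).IsHomogeneous k := by
  induction k generalizing i j with
  | zero =>
      rw [pow_zero, Matrix.one_apply]
      split_ifs
      · exact isHomogeneous_one _ _
      · exact isHomogeneous_zero _ _ _
  | succ k ih =>
      rw [pow_succ, Matrix.mul_apply]
      refine IsHomogeneous.sum _ _ _ fun l _ => ?_
      have hX : (Matrix.mvPolynomialX (Fin n) (Fin n) ℂ l j).IsHomogeneous 1 := by
        rw [Matrix.mvPolynomialX_apply]; exact isHomogeneous_X ℂ (l, j)
      exact (ih i l).mul hX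

/-- The power trace `tr(X³)` of the generic `n × n` matrix is a cubic form. -/
theorem isHomogeneous_tracePow_three (n : ℕ) :
    ((Matrix.mvPolynomialX (Fin n) (Fin n) ℂ ^ 3).trace).IsHomogeneous 3 := by
  unfold Matrix.trace
  exact IsHomogeneous.sum _ _ _ fun i _ => isHomogeneous_mvPolynomialX_pow_apply n 3 i i

/-- `tr(X³) ≠ 0` for `n ≥ 1` (it evaluates to `tr(1) = n` at the identity matrix). -/
theorem tracePow_three_ne_zero {n : ℕ} (hn : 0 < n) :
    (Matrix.mvPolynomialX (Fin n) (Fin n) ℂ ^ 3).trace ≠ 0 := by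
  intro h
  have h1 := congr_arg (MvPolynomial.eval fun p : Fin n × Fin n => (1 : Matrix (Fin n) (Fin n) ℂ) p.1 p.2) h
  rw [map_zero, AddMonoidHom.map_trace, ← RingHom.mapMatrix_apply, map_pow,
    Matrix.mvPolynomialX_mapMatrix_eval, one_pow, Matrix.trace_one, Fintype.card_fin] at h1
  exact (Nat.cast_ne_zero.2 hn.ne') h1

/-- **Border power-trace complexity of `per_3` is at least `4` (geometric form):**
`per_3 ∉ Δ(tr X_3³)`, the orbit closure of the power trace of the generic `3 × 3` matrix under
`GL_9` — by orbit dimensions: `dim 𝔤𝔩(ℂ⁹)_{per_3} ≤ 4 < 8 ≤ dim 𝔤𝔩(ℂ⁹)_{tr X³}`. -/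
theorem perPoly_three_not_mem_orbitClosure_tracePow_three :
    perPoly (Fin 3) ℂ ∉ orbitClosure ((Matrix.mvPolynomialX (Fin 3) (Fin 3) ℂ ^ 3).trace) := by
  have hP : (perPoly (Fin 3) ℂ).IsHomogeneous 3 := by
    have h := perPoly_isHomogeneous (n := Fin 3) (k := ℂ)
    rwa [Fintype.card_fin] at h
  refine not_mem_orbitClosure_of_finrank_glAnn_lt hP (isHomogeneous_tracePow_three 3)
    (perPoly_ne_zero (Fin 3) ℂ) (tracePow_three_ne_zero (by norm_num)) ?_
  have h1 := finrank_glAnn_perPoly_three_le_four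
  have h2 := sq_sub_one_le_finrank_glAnn_tracePow_three 3
  norm_num at h2
  omega

/-- **Exact power-trace complexity of `per_3` is at least `4`**: `per_3 ≠ tr(A³)` for every `3 × 3`
matrix `A` of linear forms in the nine variables (such a representation is a linear substitution of
`tr(X³)`, hence lies in `End(ℂ⁹)·tr(X³) ⊆ Δ(tr X³)`). -/
theorem not_exists_tracePow_three_repr_perPoly_three :
    ¬ ∃ A : Matrix (Fin 3) (Fin 3) (MvPolynomial (Fin 3 × Fin 3) ℂ),
      (∀ i j, (A i j).IsHomogeneous 1) ∧ (A ^ 3).trace = perPoly (Fin 3) ℂ := by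
  rintro ⟨A, hA, htr⟩
  apply perPoly_three_not_mem_orbitClosure_tracePow_three
  -- the substitution `x_(i,j) ↦ A_(i,j)` is the linear substitution by the coefficient matrix `L`
  set L : Matrix (Fin 3 × Fin 3) (Fin 3 × Fin 3) ℂ :=
    fun v p => coeff (Finsupp.single v 1) (A p.1 p.2) with hL
  have hlin : linSubst (Fin 3 × Fin 3) ℂ L =
      aeval (fun p : Fin 3 × Fin 3 => A p.1 p.2) := by
    unfold linSubst
    congr 1
    funext p
    rw [eq_sum_coeff_single_mul_X (hA p.1 p.2)]
    refine Finset.sum_congr rfl fun v _ => ?_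
    rw [smul_eq_C_mul]
  have hmem : perPoly (Fin 3) ℂ ∈ endOrbit (Fin 3 × Fin 3) ℂ
      ((Matrix.mvPolynomialX (Fin 3) (Fin 3) ℂ ^ 3).trace) := by
    refine ⟨L, ?_⟩
    change linSubst (Fin 3 × Fin 3) ℂ L ((Matrix.mvPolynomialX (Fin 3) (Fin 3) ℂ ^ 3).trace) =
      perPoly (Fin 3) ℂ
    rw [hlin, AddMonoidHom.map_trace, ← AlgHom.mapMatrix_apply, map_pow,
      Matrix.mvPolynomialX_mapMatrix_aeval, htr]
  exact endOrbit_subset_orbitClosure_holds _ hmem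

end Summit.ValiantsHypothesis.ValiantsHypothesis.Theorems.SchenstedIndex

end
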